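import Mathlib
import HarnessLib
import Summits.Ventures.LatticeQCDFlow.Exactness.SUNMomentumLawMoments

/-!
# The momentum heat-bath checks in GENERAL coordinates of `𝔰𝔲(N)` (kinetic term `κΣ_l‖p_l‖²` on any `d`-dimensional normed space, any additive Haar measure): `E T_κ = d|L|/2`, the links are independent, `Var T_κ = d|L|/2`

HONEST FRAMING: exact (Metropolis-corrected) sampling algorithms for lattice gauge theory;
figures of merit are autocorrelation/cost numbers at stated couplings and volumes; no
continuum-physics claim.

Venture `LatticeQCDFlow` (cell pub-lqcd), topic `Exactness`, FANOUT row 14 (eng-flowhmc; the SETTING of the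
general-coordinates `SU(N)` files `SUNLeapfrogEnergyError` / `SUNLeapfrogMeanAcceptance` / `SUNOmf2MeanAcceptance`:
momenta `p_l ∈ E`, `E` any finite-dimensional real normed space of dimension `d`, refresh law
`Z⁻¹e^{−κΣ_l‖p_l‖²}dμ^{⊗L}` for an additive Haar measure `μ`).  The general twin of `SU2KineticVariance` (`d = 3`,
Euclidean norm) — here for ANY norm.  NEW WORK of the cell over `SUNMomentumLawMoments` (radial moments by polar
coordinates for any norm + Gamma; one-link Tonelli; `E‖p_l‖² = d/(2κ)`); nothing here is cited as a fact.

* §1 **the fourth radial moment** `∫‖v‖⁴e^{−κ‖v‖²}dμ = (d(d+2)/(4κ²))∫e^{−κ‖v‖²}dμ` (`Γ(d/2+2) = (d/2+1)(d/2)Γ(d/2)`),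
  hence **`E‖p_l‖⁴ = d(d+2)/(4κ²)`** and **`Var(κ‖p_l‖²) = E(κ‖p_l‖² − d/2)² = d/2`** per link;
* §2 **the links are independent under the heat-bath**: Tonelli for a product of one-link observables and
  **`E ∏_m φ_m(p_m) = ∏_m (∫φ_m e^{−κ‖v‖²}dμ)/(∫e^{−κ‖v‖²}dμ)`**;
* §3 **`E ‖p_l‖²‖p_{l'}‖² = (d/(2κ))²` for `l ≠ l'`**, **`E T_κ = d|L|/2`**, **`E T_κ² = d|L|/2 + (d|L|/2)²`** and
  **`Var T_κ = E(T_κ − d|L|/2)² = d|L|/2`** — `κ`-free and norm-free.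

NOT CLAIMED: the full law of `T_κ`; anything numerical; floating point.
-/

noncomputable section
namespace Summit.Ventures.LatticeQCDFlow.Exactness

open Set MeasureTheory Metric Filter
open scoped ENNReal

variable {E : Type*} [NormedAddCommGroup E] [NormedSpace ℝ E] [FiniteDimensional ℝ E] [Nontrivial E]
  [MeasurableSpace E] [BorelSpace E] (μ : Measure E) [μ.IsAddHaarMeasure]

/-! ## §1 The fourth radial moment and the one-link variance -/

section OneLink

/-- **`∫ ‖v‖⁴ e^{−κ‖v‖²} dμ = (d(d+2)/(4κ²)) ∫ e^{−κ‖v‖²} dμ`** (`Γ(d/2 + 2) = (d/2 + 1)(d/2)Γ(d/2)`). -/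
theorem integral_norm_pow_four_mul_exp_neg_mul_sq_norm_addHaar {κ : ℝ} (hκ : 0 < κ) :
    ∫ v, ‖v‖ ^ 4 * Real.exp (-κ * ‖v‖ ^ 2) ∂μ =
      (Module.finrank ℝ E : ℝ) * (Module.finrank ℝ E + 2) / (4 * κ ^ 2) * ∫ v, Real.exp (-κ * ‖v‖ ^ 2) ∂μ := by
  have h0 := integral_norm_pow_mul_exp_neg_mul_sq_norm_addHaar μ hκ 0
  simp only [pow_zero, one_mul, Nat.cast_zero, zero_add] at h0
  rw [integral_norm_pow_mul_exp_neg_mul_sq_norm_addHaar μ hκ 4, h0]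
  have hd : (0 : ℝ) < Module.finrank ℝ E := by exact_mod_cast (Module.finrank_pos : 0 < Module.finrank ℝ E)
  have h7 : Real.Gamma ((((4 : ℕ) : ℝ) + Module.finrank ℝ E) / 2) =
      ((Module.finrank ℝ E : ℝ) / 2 + 1) * (((Module.finrank ℝ E : ℝ) / 2) * Real.Gamma ((Module.finrank ℝ E : ℝ) / 2)) := by
    rw [show (((4 : ℕ) : ℝ) + Module.finrank ℝ E) / 2 = (Module.finrank ℝ E : ℝ) / 2 + 1 + 1 by push_cast; ring,
      Real.Gamma_add_one (by positivity), Real.Gamma_add_one (by positivity)]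
  have hk : κ ^ (-(((4 : ℕ) : ℝ) + Module.finrank ℝ E) / 2) = κ ^ (-(Module.finrank ℝ E : ℝ) / 2) * (κ ^ 2)⁻¹ := by
    rw [show (-(((4 : ℕ) : ℝ) + Module.finrank ℝ E) / 2) = (-(Module.finrank ℝ E : ℝ) / 2) + (-2) by push_cast; ring,
      Real.rpow_add hκ, show (-2 : ℝ) = -((2 : ℕ) : ℝ) by norm_num, Real.rpow_neg hκ.le, Real.rpow_natCast]
  rw [h7, hk]
  field_simp
  ring

variable {ι : Type*} [Fintype ι]

/-- **`E‖p_l‖⁴ = d(d+2)/(4κ²)`** under the refresh law `Z⁻¹e^{−κΣ‖p_l‖²}dμ^{⊗L}`. -/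
theorem integral_norm_apply_pow_four_sunMomentumLaw {κ : ℝ} (hκ : 0 < κ) (l : ι) :
    ∫ p, ‖p l‖ ^ 4 ∂(sunMomentumLaw (L := ι) μ fun p => κ * ∑ l, ‖p l‖ ^ 2) =
      (Module.finrank ℝ E : ℝ) * (Module.finrank ℝ E + 2) / (4 * κ ^ 2) := by
  rw [integral_norm_apply_pow_sunMomentumLaw μ hκ 4 l, integral_norm_pow_four_mul_exp_neg_mul_sq_norm_addHaar μ hκ,
    mul_div_assoc, div_self (integral_exp_neg_mul_sq_norm_addHaar_pos μ hκ).ne', mul_one]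

/-- **`Var(κ‖p_l‖²) = E(κ‖p_l‖² − d/2)² = d/2`** per link. -/
theorem variance_kinetic_apply_sunMomentumLaw {κ : ℝ} (hκ : 0 < κ) (l : ι) :
    ∫ p, (κ * ‖p l‖ ^ 2 - (Module.finrank ℝ E : ℝ) / 2) ^ 2 ∂(sunMomentumLaw (L := ι) μ fun p => κ * ∑ l, ‖p l‖ ^ 2) =
      (Module.finrank ℝ E : ℝ) / 2 := by
  haveI := isProbabilityMeasure_sunMomentumLaw_normSq (L := ι) μ hκ
  set ν := sunMomentumLaw (L := ι) μ fun p => κ * ∑ l, ‖p l‖ ^ 2 with hν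
  set D : ℝ := (Module.finrank ℝ E : ℝ) with hD
  have hi4 := integrable_norm_apply_pow_sunMomentumLaw (L := ι) μ hκ 4 l
  have hi2 := integrable_norm_apply_pow_sunMomentumLaw (L := ι) μ hκ 2 l
  have h4 := integral_norm_apply_pow_four_sunMomentumLaw (ι := ι) μ hκ l
  have h2 := integral_norm_apply_sq_sunMomentumLaw (L := ι) μ hκ l
  have hexp : ∀ p : ι → E, (κ * ‖p l‖ ^ 2 - D / 2) ^ 2 = κ ^ 2 * ‖p l‖ ^ 4 - D * κ * ‖p l‖ ^ 2 + D ^ 2 / 4 := fun p => by ring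
  simp_rw [hexp]
  have hA : Integrable (fun p : ι → E => κ ^ 2 * ‖p l‖ ^ 4) ν := hi4.const_mul _
  have hB : Integrable (fun p : ι → E => D * κ * ‖p l‖ ^ 2) ν := hi2.const_mul _
  have hsub : Integrable (fun p : ι → E => κ ^ 2 * ‖p l‖ ^ 4 - D * κ * ‖p l‖ ^ 2) ν := hA.sub hB
  rw [integral_add hsub (integrable_const _), integral_sub hA hB, integral_const_mul, integral_const_mul, integral_const,
    smul_eq_mul, probReal_univ, one_mul, h4, h2, ← hD]
  field_simp
  ring

end OneLink

/-! ## §2 The links are independent under the heat-bath -/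

section Product

variable {ι : Type*} [Fintype ι]

omit [Nontrivial E] in
/-- **Tonelli for a product of one-link observables against `e^{−κΣ‖p_l‖²}`**:
`∫⁻ ∏_m φ_m(p_m) e^{−κΣ‖p_l‖²} dμ^{⊗L} = ∏_m ∫ φ_m e^{−κ‖v‖²} dμ` (`φ_m ≥ 0` measurable, `φ_m e^{−κ‖v‖²}` integrable). -/
theorem lintegral_prod_apply_sunMomentumWeight_normSq {κ : ℝ} {φ : ι → E → ℝ}
    (hφ0 : ∀ m v, 0 ≤ φ m v) (hφm : ∀ m, Measurable (φ m))
    (hφi : ∀ m, Integrable (fun v => φ m v * Real.exp (-κ * ‖v‖ ^ 2)) μ) :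
    ∫⁻ p, ENNReal.ofReal (∏ m, φ m (p m)) ∂(sunMomentumWeight (L := ι) μ fun p => κ * ∑ l, ‖p l‖ ^ 2) =
      ∏ m, ENNReal.ofReal (∫ v, φ m v * Real.exp (-κ * ‖v‖ ^ 2) ∂μ) := by
  set F : ι → E → ℝ≥0∞ := fun m v => ENNReal.ofReal (φ m v * Real.exp (-κ * ‖v‖ ^ 2)) with hF
  have hFm : ∀ m, Measurable (F m) := fun m =>
    ((hφm m).mul (Real.measurable_exp.comp (measurable_const.mul (measurable_norm.pow_const 2)))).ennreal_ofReal
  have hdens : ∀ p : ι → E,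
      ENNReal.ofReal (Real.exp (-(κ * ∑ l, ‖p l‖ ^ 2))) * ENNReal.ofReal (∏ m, φ m (p m)) = ∏ m, F m (p m) := by
    intro p
    have h1 : Real.exp (-(κ * ∑ l, ‖p l‖ ^ 2)) = ∏ m, Real.exp (-κ * ‖p m‖ ^ 2) := by
      rw [← Real.exp_sum, Finset.mul_sum, ← Finset.sum_neg_distrib]
      exact congrArg Real.exp (Finset.sum_congr rfl fun m _ => by ring)
    rw [h1, ← ENNReal.ofReal_mul (Finset.prod_nonneg fun m _ => (Real.exp_pos _).le), ← Finset.prod_mul_distrib,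
      ENNReal.ofReal_prod_of_nonneg fun m _ => mul_nonneg (Real.exp_pos _).le (hφ0 m _)]
    exact Finset.prod_congr rfl fun m _ => by rw [hF, mul_comm]
  have hmd : Measurable (fun p : ι → E => ENNReal.ofReal (Real.exp (-(κ * ∑ l, ‖p l‖ ^ 2)))) :=
    (measurable_normSqKinetic κ).neg.exp.ennreal_ofReal
  have hmφ : Measurable (fun p : ι → E => ENNReal.ofReal (∏ m, φ m (p m))) :=
    (Finset.measurable_prod _ fun m _ => (hφm m).comp (measurable_pi_apply m)).ennreal_ofReal
  rw [sunMomentumWeight, lintegral_withDensity_eq_lintegral_mul _ hmd hmφ]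
  have hfun : ((fun p : ι → E => ENNReal.ofReal (Real.exp (-(κ * ∑ l, ‖p l‖ ^ 2)))) *
      fun p => ENNReal.ofReal (∏ m, φ m (p m))) = fun p => ∏ m, F m (p m) := funext hdens
  rw [hfun, lintegral_prod_pi (fun _ : ι => μ) hFm]
  refine Finset.prod_congr rfl fun m _ => ?_
  rw [hF, ← ofReal_integral_eq_lintegral_ofReal (hφi m)
    (Eventually.of_forall fun v => mul_nonneg (hφ0 m v) (Real.exp_pos _).le)]

/-- **THE LINKS ARE INDEPENDENT UNDER THE HEAT-BATH** (general coordinates):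
`E ∏_m φ_m(p_m) = ∏_m (∫ φ_m e^{−κ‖v‖²} dμ)/(∫ e^{−κ‖v‖²} dμ)`. -/
theorem integral_prod_apply_sunMomentumLaw_normSq {κ : ℝ} (hκ : 0 < κ) {φ : ι → E → ℝ}
    (hφ0 : ∀ m v, 0 ≤ φ m v) (hφm : ∀ m, Measurable (φ m))
    (hφi : ∀ m, Integrable (fun v => φ m v * Real.exp (-κ * ‖v‖ ^ 2)) μ) :
    ∫ p, ∏ m, φ m (p m) ∂(sunMomentumLaw (L := ι) μ fun p => κ * ∑ l, ‖p l‖ ^ 2) =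
      ∏ m, (∫ v, φ m v * Real.exp (-κ * ‖v‖ ^ 2) ∂μ) / ∫ v, Real.exp (-κ * ‖v‖ ^ 2) ∂μ := by
  have hJ0 := integral_exp_neg_mul_sq_norm_addHaar_pos μ hκ
  have hJk : ∀ m, 0 ≤ ∫ v, φ m v * Real.exp (-κ * ‖v‖ ^ 2) ∂μ := fun m =>
    integral_nonneg fun v => mul_nonneg (hφ0 m v) (Real.exp_pos _).le
  have hmeas : Measurable fun p : ι → E => ∏ m, φ m (p m) :=
    Finset.measurable_prod _ fun m _ => (hφm m).comp (measurable_pi_apply m)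
  rw [integral_eq_lintegral_of_nonneg_ae (Eventually.of_forall fun p => Finset.prod_nonneg fun m _ => hφ0 m _)
    hmeas.aestronglyMeasurable, sunMomentumLaw, lintegral_smul_measure,
    lintegral_prod_apply_sunMomentumWeight_normSq μ hφ0 hφm hφi, sunMomentumWeight_normSq_univ μ hκ, smul_eq_mul,
    ENNReal.toReal_mul, ENNReal.toReal_inv, ENNReal.toReal_pow, ENNReal.toReal_prod, ENNReal.toReal_ofReal hJ0.le]
  simp_rw [ENNReal.toReal_ofReal (hJk _)]
  rw [Finset.prod_div_distrib, Finset.prod_const, Finset.card_univ, div_eq_inv_mul]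

/-! ## §3 Two-link expectations, `E T_κ`, `E T_κ²`, `Var T_κ` -/

/-- **`E ‖p_l‖²·‖p_{l'}‖² = (d/(2κ))²` for distinct links.** -/
theorem integral_norm_sq_mul_norm_sq_sunMomentumLaw {κ : ℝ} (hκ : 0 < κ) {l l' : ι} (hll' : l ≠ l') :
    ∫ p, ‖p l‖ ^ 2 * ‖p l'‖ ^ 2 ∂(sunMomentumLaw (L := ι) μ fun p => κ * ∑ l, ‖p l‖ ^ 2) =
      ((Module.finrank ℝ E : ℝ) / (2 * κ)) ^ 2 := by
  classical
  set φ : ι → E → ℝ := fun m v => if m = l ∨ m = l' then ‖v‖ ^ 2 else 1 with hφ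
  have hφ0 : ∀ m v, 0 ≤ φ m v := fun m v => by
    by_cases h : m = l ∨ m = l'
    · simp only [hφ, h, if_true]; positivity
    · simp only [hφ, h, if_false]; exact zero_le_one
  have hφm : ∀ m, Measurable (φ m) := fun m => by
    by_cases h : m = l ∨ m = l'
    · simp only [hφ, h, if_true]; exact measurable_norm.pow_const 2
    · simp only [hφ, h, if_false]; exact measurable_const
  have hi2 := integrable_norm_pow_mul_exp_neg_mul_sq_norm_addHaar μ hκ 2
  have hi0 := integrable_norm_pow_mul_exp_neg_mul_sq_norm_addHaar μ hκ 0
  simp only [pow_zero, one_mul] at hi0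
  have hφi : ∀ m, Integrable (fun v => φ m v * Real.exp (-κ * ‖v‖ ^ 2)) μ := fun m => by
    by_cases h : m = l ∨ m = l'
    · simp only [hφ, h, if_true]; exact hi2
    · simp only [hφ, h, if_false, one_mul]; exact hi0
  have hprod : ∀ p : ι → E, ∏ m, φ m (p m) = ‖p l‖ ^ 2 * ‖p l'‖ ^ 2 := by
    intro p
    rw [← Finset.mul_prod_erase Finset.univ (fun m => φ m (p m)) (Finset.mem_univ l),
      ← Finset.mul_prod_erase (Finset.univ.erase l) (fun m => φ m (p m))
        (Finset.mem_erase.2 ⟨hll'.symm, Finset.mem_univ l'⟩)]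
    have hl : φ l (p l) = ‖p l‖ ^ 2 := by simp only [hφ, true_or, if_true]
    have hl' : φ l' (p l') = ‖p l'‖ ^ 2 := by simp only [hφ, or_true, if_true]
    have hrest : ∏ m ∈ (Finset.univ.erase l).erase l', φ m (p m) = 1 := by
      refine Finset.prod_eq_one fun m hm => ?_
      have h1 : m ≠ l' := Finset.ne_of_mem_erase hm
      have h2 : m ≠ l := Finset.ne_of_mem_erase (Finset.mem_of_mem_erase hm)
      have h : ¬(m = l ∨ m = l') := not_or.2 ⟨h2, h1⟩
      simp only [hφ, h, if_false]
    rw [hl, hl', hrest, mul_one]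
  have h := integral_prod_apply_sunMomentumLaw_normSq (ι := ι) μ hκ hφ0 hφm hφi
  simp_rw [hprod] at h
  rw [h]
  set Z₁ : ℝ := ∫ v, Real.exp (-κ * ‖v‖ ^ 2) ∂μ with hZ₁
  have hZ0 : Z₁ ≠ 0 := (integral_exp_neg_mul_sq_norm_addHaar_pos μ hκ).ne'
  have hJD : (∫ v, ‖v‖ ^ 2 * Real.exp (-κ * ‖v‖ ^ 2) ∂μ) / Z₁ = (Module.finrank ℝ E : ℝ) / (2 * κ) := by
    rw [integral_norm_sq_mul_exp_neg_mul_sq_norm_addHaar μ hκ, hZ₁.symm, mul_div_assoc, div_self hZ0, mul_one]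
  have hratio : ∀ m, (∫ v, φ m v * Real.exp (-κ * ‖v‖ ^ 2) ∂μ) / Z₁ =
      if m = l ∨ m = l' then (Module.finrank ℝ E : ℝ) / (2 * κ) else 1 := by
    intro m
    by_cases h : m = l ∨ m = l'
    · simp only [hφ, h, if_true]; exact hJD
    · simp only [hφ, h, if_false, one_mul]; exact div_self hZ0
  rw [Finset.prod_congr rfl fun m _ => hratio m,
    ← Finset.mul_prod_erase Finset.univ _ (Finset.mem_univ l),
    ← Finset.mul_prod_erase (Finset.univ.erase l) _ (Finset.mem_erase.2 ⟨hll'.symm, Finset.mem_univ l'⟩)]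
  have hrest1 : ∏ m ∈ (Finset.univ.erase l).erase l',
      (if m = l ∨ m = l' then (Module.finrank ℝ E : ℝ) / (2 * κ) else (1 : ℝ)) = 1 := by
    refine Finset.prod_eq_one fun m hm => ?_
    have h1 : m ≠ l' := Finset.ne_of_mem_erase hm
    have h2 : m ≠ l := Finset.ne_of_mem_erase (Finset.mem_of_mem_erase hm)
    rw [if_neg (not_or.2 ⟨h2, h1⟩)]
  rw [hrest1, if_pos (Or.inl rfl), if_pos (Or.inr rfl), mul_one, sq]

/-- `‖p_l‖²‖p_{l'}‖²` is integrable under the refresh law (any two links; `ab ≤ (a²+b²)/2`). -/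
theorem integrable_norm_sq_mul_norm_sq_sunMomentumLaw {κ : ℝ} (hκ : 0 < κ) (l l' : ι) :
    Integrable (fun p : ι → E => ‖p l‖ ^ 2 * ‖p l'‖ ^ 2) (sunMomentumLaw (L := ι) μ fun p => κ * ∑ l, ‖p l‖ ^ 2) := by
  refine (((integrable_norm_apply_pow_sunMomentumLaw (L := ι) μ hκ 4 l).add
    (integrable_norm_apply_pow_sunMomentumLaw (L := ι) μ hκ 4 l')).div_const 2).mono'
    (((measurable_pi_apply l).norm.pow_const 2).mul ((measurable_pi_apply l').norm.pow_const 2)).aestronglyMeasurable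
    (Eventually.of_forall fun p => ?_)
  rw [Real.norm_eq_abs, abs_of_nonneg (by positivity)]
  have hsq := sq_nonneg (‖p l‖ ^ 2 - ‖p l'‖ ^ 2)
  have hexp : (‖p l‖ ^ 2 - ‖p l'‖ ^ 2) ^ 2 = ‖p l‖ ^ 4 + ‖p l'‖ ^ 4 - 2 * (‖p l‖ ^ 2 * ‖p l'‖ ^ 2) := by ring
  simp only [Pi.add_apply] at *
  linarith

/-- **`E T_κ = d|L|/2`** (`κ`-free, norm-free). -/
theorem integral_normSqKinetic_sunMomentumLaw {κ : ℝ} (hκ : 0 < κ) :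
    ∫ p, κ * ∑ l, ‖p l‖ ^ 2 ∂(sunMomentumLaw (L := ι) μ fun p => κ * ∑ l, ‖p l‖ ^ 2) =
      Fintype.card ι * ((Module.finrank ℝ E : ℝ) / 2) := by
  have hi2 := fun l : ι => integrable_norm_apply_pow_sunMomentumLaw (L := ι) μ hκ 2 l
  rw [integral_const_mul, integral_finsetSum _ fun l _ => hi2 l,
    Finset.sum_congr rfl fun l _ => integral_norm_apply_sq_sunMomentumLaw (L := ι) μ hκ l,
    Finset.sum_const, Finset.card_univ, nsmul_eq_mul]
  field_simp

/-- **`E T_κ² = d|L|/2 + (d|L|/2)²`.** -/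
theorem integral_normSqKinetic_sq_sunMomentumLaw {κ : ℝ} (hκ : 0 < κ) :
    ∫ p, (κ * ∑ l, ‖p l‖ ^ 2) ^ 2 ∂(sunMomentumLaw (L := ι) μ fun p => κ * ∑ l, ‖p l‖ ^ 2) =
      Fintype.card ι * ((Module.finrank ℝ E : ℝ) / 2) + (Fintype.card ι * ((Module.finrank ℝ E : ℝ) / 2)) ^ 2 := by
  classical
  set ν := sunMomentumLaw (L := ι) μ fun p => κ * ∑ l, ‖p l‖ ^ 2 with hν
  set D : ℝ := (Module.finrank ℝ E : ℝ) with hD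
  have hsq : ∀ p : ι → E, (κ * ∑ l, ‖p l‖ ^ 2) ^ 2 = κ ^ 2 * ∑ l, ∑ l', ‖p l‖ ^ 2 * ‖p l'‖ ^ 2 := by
    intro p; rw [mul_pow, sq (∑ l, ‖p l‖ ^ 2), Finset.sum_mul_sum]
  simp_rw [hsq]
  rw [integral_const_mul, integral_finsetSum _ fun l _ => integrable_finsetSum _ fun l' _ =>
    integrable_norm_sq_mul_norm_sq_sunMomentumLaw (ι := ι) μ hκ l l']
  have hinner : ∀ l : ι, ∫ p, ∑ l', ‖p l‖ ^ 2 * ‖p l'‖ ^ 2 ∂ν = D * (D + 2) / (4 * κ ^ 2) + (Fintype.card ι - 1) * (D / (2 * κ)) ^ 2 := by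
    intro l
    rw [integral_finsetSum _ fun l' _ => integrable_norm_sq_mul_norm_sq_sunMomentumLaw (ι := ι) μ hκ l l',
      ← Finset.add_sum_erase _ _ (Finset.mem_univ l)]
    have hdiag : ∫ p, ‖p l‖ ^ 2 * ‖p l‖ ^ 2 ∂ν = D * (D + 2) / (4 * κ ^ 2) := by
      rw [hD, ← integral_norm_apply_pow_four_sunMomentumLaw (ι := ι) μ hκ l]
      exact integral_congr_ae (Eventually.of_forall fun p => by ring)
    have hoff : ∑ l' ∈ Finset.univ.erase l, ∫ p, ‖p l‖ ^ 2 * ‖p l'‖ ^ 2 ∂ν = ∑ _l' ∈ Finset.univ.erase l, (D / (2 * κ)) ^ 2 :=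
      Finset.sum_congr rfl fun l' hl' => by
        rw [hD]; exact integral_norm_sq_mul_norm_sq_sunMomentumLaw (ι := ι) μ hκ (Finset.ne_of_mem_erase hl').symm
    rw [hdiag, hoff, Finset.sum_const, Finset.card_erase_of_mem (Finset.mem_univ l), Finset.card_univ, nsmul_eq_mul,
      Nat.cast_sub (Fintype.card_pos_iff.2 ⟨l⟩), Nat.cast_one]
  rw [Finset.sum_congr rfl fun l _ => hinner l, Finset.sum_const, Finset.card_univ, nsmul_eq_mul]
  field_simp
  ring

/-- **`Var T_κ = E(T_κ − d|L|/2)² = d|L|/2`** — the error bar of the equipartition check in any coordinates. -/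
theorem variance_normSqKinetic_sunMomentumLaw {κ : ℝ} (hκ : 0 < κ) :
    ∫ p, (κ * ∑ l, ‖p l‖ ^ 2 - Fintype.card ι * ((Module.finrank ℝ E : ℝ) / 2)) ^ 2
        ∂(sunMomentumLaw (L := ι) μ fun p => κ * ∑ l, ‖p l‖ ^ 2) =
      Fintype.card ι * ((Module.finrank ℝ E : ℝ) / 2) := by
  haveI := isProbabilityMeasure_sunMomentumLaw_normSq (L := ι) μ hκ
  set ν := sunMomentumLaw (L := ι) μ fun p => κ * ∑ l, ‖p l‖ ^ 2 with hν
  set M : ℝ := Fintype.card ι * ((Module.finrank ℝ E : ℝ) / 2) with hM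
  have hi1 : Integrable (fun p : ι → E => κ * ∑ l, ‖p l‖ ^ 2) ν :=
    (integrable_finsetSum _ fun l _ => integrable_norm_apply_pow_sunMomentumLaw (L := ι) μ hκ 2 l).const_mul κ
  have hi2 : Integrable (fun p : ι → E => (κ * ∑ l, ‖p l‖ ^ 2) ^ 2) ν := by
    have h : ∀ p : ι → E, (κ * ∑ l, ‖p l‖ ^ 2) ^ 2 = κ ^ 2 * ∑ l, ∑ l', ‖p l‖ ^ 2 * ‖p l'‖ ^ 2 := by
      intro p; rw [mul_pow, sq (∑ l, ‖p l‖ ^ 2), Finset.sum_mul_sum]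
    simp_rw [h]
    exact (integrable_finsetSum _ fun l _ => integrable_finsetSum _ fun l' _ =>
      integrable_norm_sq_mul_norm_sq_sunMomentumLaw (ι := ι) μ hκ l l').const_mul _
  have hexp : ∀ p : ι → E, (κ * ∑ l, ‖p l‖ ^ 2 - M) ^ 2 =
      (κ * ∑ l, ‖p l‖ ^ 2) ^ 2 - 2 * M * (κ * ∑ l, ‖p l‖ ^ 2) + M ^ 2 := by
    intro p; ring
  simp_rw [hexp]
  have hMq : Integrable (fun p : ι → E => 2 * M * (κ * ∑ l, ‖p l‖ ^ 2)) ν := hi1.const_mul _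
  have hsub : Integrable (fun p : ι → E => (κ * ∑ l, ‖p l‖ ^ 2) ^ 2 - 2 * M * (κ * ∑ l, ‖p l‖ ^ 2)) ν := hi2.sub hMq
  rw [integral_add hsub (integrable_const _), integral_sub hi2 hMq, integral_const_mul, integral_const, smul_eq_mul,
    probReal_univ, one_mul, integral_normSqKinetic_sq_sunMomentumLaw (ι := ι) μ hκ,
    integral_normSqKinetic_sunMomentumLaw (ι := ι) μ hκ, ← hM]
  ring

end Product

end Summit.Ventures.LatticeQCDFlow.Exactness
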